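import Summits.Ventures.HSemireg.HomComplexSigmaCyclic
import HarnessLib

/-!
# `σ` in every Ext-degree: the Atiyah–trace maps `τ^(d)_q : Ext^d(K•, K•) → Hom_D(Q 𝒪_X[0], (Q Ω^q_X[0])⟦q + d⟧)` and their cyclic / gluing laws

Cell `pub-hsemireg`, theory seat th-2 (LAW A′ of `theory/TH2-SIGMA-GLUING-LAWS.md` v1.7 §1: «LAW A in EVERY Ext-degree»).
HONEST FRAMING: kernel plumbing on seat t-7's real carriers (`HomComplexSigma.lean`); ONE definition with a body per level
(`extMulAtiyahPowerDeg`, `HomComplex.phiMulAtiyahPowerDeg`, `HomComplex.tauC` — the degree-`d` analogues of t-7's degree-`2`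
`extMulAtiyahPower` / `phiMulAtiyahPower` / `sigmaC`, to which they are PROVED equal at `d = 2`), theorems otherwise; NOT a door,
NOT a named fact, nothing about any variety or conjecture; nothing here says HC / HC_CM / HC_AV is proved.

## What this file does

t-7's `HomComplex.sigmaC X K a b hK q x` is typed at `x : Q K• ⟶ (Q K•)⟦2⟧` (the semiregularity map on `Ext²`, where obstructions
live).  The SAME composite `Q(unit) ≫ Φ_K(x · ι• · At(K•)^q) ≫ Q(Tr•)⟦q + d⟧` makes sense for a class `x` of ANY degree `d`; at `d = 1`
it is the Atiyah–trace («box» / `τ₁`) map on first-order deformations `Ext¹(K•, K•) → ⊕_q H^{q+1}(Ω^q)` used by the cell's W5 group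
(`widen/W5/TABLE-W5-N6.md` §HEX-6) and by seat th-7's FORMULA-N PART B.  The proofs of the two landed σ-laws — `HomComplex.sigmaC_gluing`
(`HomComplexSigmaGluing.lean`) and `HomComplex.sigmaC_cyclic` (`HomComplexSigmaCyclic.lean`) — never use `d = 2`: Atiyah naturality
(`complexAtiyahPowerFrom_naturality'`), functoriality of `Φ` (`shiftedHomMap_mk₀_comp` / `shiftedHomMap_comp_mk₀` / `shiftedHomMap_premap`),
dinaturality of the supertrace (`supertraceH_dinatural`) and the head identity `unitQ_comp_map_comp_premap` are degree-free.  This file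
records that:

* §1 `extMulAtiyahPowerDeg X K q x := x · (ι• · At(K•)^q)` for `x` of degree `d`; `HomComplex.phiMulAtiyahPowerDeg`; `HomComplex.tauC X K a b hK q x m hm`
  (the output degree `m`, `0 + (q + d) = m`, is an explicit argument so that the `d = 2` instance has t-7's type on the nose).
* §2 ANCHOR: `extMulAtiyahPowerDeg_two`, `HomComplex.tauC_two_eq_sigmaC` — at `d = 2` these ARE t-7's `extMulAtiyahPower` / `sigmaC`.
* §3 `HomComplex.tauC_cyclic`: for chain maps `i : K₁• ⟶ K•`, `p : K• ⟶ K₀•` (NO relation assumed) and `ψ : Q K₀• ⟶ (Q K₁•)⟦d⟧`,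
  `τ^K(Q p ≫ ψ ≫ Q i⟦d⟧) = τ^{K₁}(Q(i ≫ p) ≫ ψ)` — trace cyclicity in every degree ([BF03] §4).
* §4 COROLLARIES: `HomComplex.tauC_gluing` (`i ≫ p = 0` ⟹ `τ = 0`: GLUING classes of every degree are invisible — LAW A′; at `d = 1`:
  first-order deformations of a glued object that move only the gluing data are killed by every Atiyah–trace map), and
  `HomComplex.tauC_shortComplex_ext_eq_zero` (short-complex packaging).
* §5 STAIRCASES (th-2 gen 23): `HomComplex.tauC_eq_zero_of_rotate` (the induction step along a filtration: a class is
  `τ`-invisible on `K•` as soon as its rotation is `τ`-invisible on the sub-object `K₁•`) and `HomComplex.tauC_gluing₃`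
  (LAW A′ for a three-step filtration `K₂• ⊂ K₁• ⊂ K•`: classes of `F¹Ext^d` are `τ`-invisible; one factorisation
  hypothesis per extra step).

References: [BuchweitzFlenner2003] R.-O. Buchweitz, H. Flenner, «A semiregularity map for modules and applications to deformations»,
Compositio Math. 137 (2003), Def. 4.1 (σ), Prop. 3.11 (naturality of At), §4 (trace map, cyclicity).
-/

noncomputable section

open CategoryTheory CategoryTheory.Limits AlgebraicGeometry Opposite

namespace Summit.Ventures.HSemireg

open Literature.AlgebraicGeometry.Modules Literature.AlgebraicGeometry.Motives
open Summit.HodgeConjecture.HodgeConjecture.Theorems.PadicPridhamSemiregularity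

/-! ## §1 The degree-`d` composites -/

section Deg

universe w₁ u₁

variable {S : Type u₁} [CommRing S] (X : Over (Spec (CommRingCat.of S))) [HasDerivedCategory.{w₁} X.left.Modules]

/-- **The argument of `τ^(d)_q`**: `x ∈ Ext^d(K•, K•)` (a degree-`d` shifted endomorphism of `Q K•`)
`↦ x · (ι• · At(K•)^q) : K• ⟶ (K• ⊗ Ω^q)[q + d]` — t-7's `extMulAtiyahPower` with the degree `2` replaced by `d`
(equal to it at `d = 2`: `extMulAtiyahPowerDeg_two`). [cite: BuchweitzFlenner2003, Def. 4.1] -/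
def extMulAtiyahPowerDeg (K : CochainComplex X.left.Modules ℤ) (q : ℕ) {d : ℤ}
    (x : ShiftedHom (DerivedCategory.Q.obj K) (DerivedCategory.Q.obj K) d) :
    ShiftedHom (DerivedCategory.Q.obj K) (DerivedCategory.Q.obj (twistHodgeComplex X q K)) ((q : ℤ) + d) :=
  x.comp (complexAtiyahPowerFrom q K) rfl

/-- ANCHOR: at `d = 2`, `extMulAtiyahPowerDeg` IS t-7's `extMulAtiyahPower` (`extMulAtiyahPower_eq_comp`). [cite: BuchweitzFlenner2003, Def. 4.1] -/
theorem extMulAtiyahPowerDeg_two (K : CochainComplex X.left.Modules ℤ) (q : ℕ)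
    (x : ShiftedHom (DerivedCategory.Q.obj K) (DerivedCategory.Q.obj K) (2 : ℤ)) :
    extMulAtiyahPowerDeg X K q x = extMulAtiyahPower X K q x :=
  (extMulAtiyahPower_eq_comp q K x).symm

namespace HomComplex

variable (K : CochainComplex X.left.Modules ℤ) (a b : ℤ) [K.IsStrictlyGE a] [K.IsStrictlyLE b]
  (hK : ∀ p, IsFiniteLocallyFree (K.X p))

/-- `Φ_K(x · ι• · At(K•)^q)` for `x` of degree `d` (t-7's `phiMulAtiyahPower` with `2 ↦ d`). [cite: BuchweitzFlenner2003, Def. 4.1] -/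
def phiMulAtiyahPowerDeg (q : ℕ) {d : ℤ} (x : ShiftedHom (DerivedCategory.Q.obj K) (DerivedCategory.Q.obj K) d) :
    ShiftedHom (DerivedCategory.Q.obj ((homFunctor X.left K).obj K))
      (DerivedCategory.Q.obj ((homFunctor X.left K).obj (twistHodgeComplex X q K))) ((q : ℤ) + d) :=
  shiftedHomMap (homFunctor X.left K) (homFunctor_isInvertedBy X K a b hK) (extMulAtiyahPowerDeg X K q x)

/-- **`τ^(d)_q` of a bounded complex of finite locally free `𝒪_X`-modules** — t-7's `sigmaC` in every Ext-degree:
`x ∈ Hom_D(Q K•, (Q K•)⟦d⟧) ↦ Q(unit) ≫ Φ_K(x · ι• · At(K•)^q) ≫ Q(Tr•)⟦q + d⟧ ∈ Hom_D(Q 𝒪_X[0], (Q Ω^q_X[0])⟦m⟧)`, the output degree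
`m` (`0 + (q + d) = m`) being an explicit argument.  `d = 2`: `tauC_two_eq_sigmaC`.  `d = 1`: the Atiyah–trace map on first-order
deformations.  Signs/factorials of BF Def. 4.1 not inserted (as in `sigmaC`). [cite: BuchweitzFlenner2003, Def. 4.1] -/
def tauC (q : ℕ) {d : ℤ} (x : ShiftedHom (DerivedCategory.Q.obj K) (DerivedCategory.Q.obj K) d) (m : ℤ)
    (hm : (0 : ℤ) + ((q : ℤ) + d) = m) :
    ShiftedHom (DerivedCategory.Q.obj ((HomologicalComplex.single X.left.Modules (ComplexShape.up ℤ) 0).obj (unitModule X.left)))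
      (DerivedCategory.Q.obj ((HomologicalComplex.single X.left.Modules (ComplexShape.up ℤ) 0).obj (hodgeSheaf X q))) m :=
  ((ShiftedHom.mk₀ (0 : ℤ) rfl (unitQ X K a b)).comp (phiMulAtiyahPowerDeg X K a b hK q x) (add_zero _)).comp
    (ShiftedHom.mk₀ (0 : ℤ) rfl (DerivedCategory.Q.map (supertraceH X K hK q))) hm

/-! ## §2 Anchor: `d = 2` is t-7's `sigmaC` -/

set_option backward.isDefEq.respectTransparency false in
/-- ANCHOR: at `d = 2`, `tauC` IS t-7's `sigmaC` (same composite; the only difference, `extMulAtiyahPower` vs. `x · (ι• · At^q)`, is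
`extMulAtiyahPower_eq_comp`). [cite: BuchweitzFlenner2003, Def. 4.1] -/
theorem tauC_two_eq_sigmaC (q : ℕ) (x : ShiftedHom (DerivedCategory.Q.obj K) (DerivedCategory.Q.obj K) (2 : ℤ)) :
    tauC X K a b hK q x ((q + 2 : ℕ) : ℤ) (by omega) = sigmaC X K a b hK q x := by
  unfold tauC sigmaC phiMulAtiyahPowerDeg phiMulAtiyahPower
  rw [extMulAtiyahPowerDeg_two]

end HomComplex

end Deg

/-! ## §3 Trace cyclicity in every degree -/

namespace HomComplex

section Cyclic

universe w₁ u₁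

variable {S : Type u₁} [CommRing S] (X : Over (Spec (CommRingCat.of S))) [HasDerivedCategory.{w₁} X.left.Modules]
  {K₁ K K₀ : CochainComplex X.left.Modules ℤ} (a b : ℤ)
  [K₁.IsStrictlyGE a] [K₁.IsStrictlyLE b] [K.IsStrictlyGE a] [K.IsStrictlyLE b]
  (hK₁ : ∀ n, IsFiniteLocallyFree (K₁.X n)) (hK : ∀ n, IsFiniteLocallyFree (K.X n))

/-- Step A in degree `d`: `(p · ψ · i) · (ι• · At^q_K) = p · ((ψ · ι•At^q_{K₁}) · (i ⊗ 1))` — naturality of `ι · At^q` along the chain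
map `i : K₁• ⟶ K•` (`complexAtiyahPowerFrom_naturality'`). [cite: BuchweitzFlenner2003, Prop. 3.11 and §4 (At^k)] -/
theorem extMulAtiyahPowerDeg_gluing (i : K₁ ⟶ K) (p : K ⟶ K₀) (q : ℕ) {d : ℤ}
    (ψ : ShiftedHom (DerivedCategory.Q.obj K₀) (DerivedCategory.Q.obj K₁) d) :
    extMulAtiyahPowerDeg X K q
        ((ShiftedHom.mk₀ (0 : ℤ) rfl (DerivedCategory.Q.map p)).comp
          (ψ.comp (ShiftedHom.mk₀ (0 : ℤ) rfl (DerivedCategory.Q.map i)) (zero_add d)) (add_zero d)) =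
      (ShiftedHom.mk₀ (0 : ℤ) rfl (DerivedCategory.Q.map p)).comp
        ((ψ.comp (complexAtiyahPowerFrom q K₁) rfl).comp
          (ShiftedHom.mk₀ (0 : ℤ) rfl (DerivedCategory.Q.map (twistHodgeComplexMap X q i))) (zero_add _))
        (add_zero _) := by
  unfold extMulAtiyahPowerDeg
  rw [shiftedHom_mk₀_comp_comp, shiftedHom_comp_mk₀_comp, ← complexAtiyahPowerFrom_naturality' X q i, shiftedHom_comp_comp_mk₀]

set_option backward.isDefEq.respectTransparency false in
include hK₁ in
/-- **Trace cyclicity of `τ` in every degree, on real carriers.**  For chain maps `i : K₁• ⟶ K•`, `p : K• ⟶ K₀•` between cochain complexes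
(`K₁•`, `K•` bounded in `[a, b]` with finite locally free terms; NO relation between `i` and `p` is assumed) and any `ψ : Q K₀• ⟶ (Q K₁•)⟦d⟧`:
`τ_q^K(Q p ≫ ψ ≫ Q i⟦d⟧) = τ_q^{K₁}(Q(i ≫ p) ≫ ψ)` in `Hom_D(Q 𝒪_X[0], (Q Ω^q[0])⟦m⟧)`.  Same proof as `sigmaC_cyclic` with `2 ↦ d`:
`extMulAtiyahPowerDeg_gluing`, `shiftedHomMap_mk₀_comp` / `shiftedHomMap_comp_mk₀`, `supertraceH_dinatural`, `shiftedHomMap_premap`,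
head `unitQ_comp_map_comp_premap`. [cite: BuchweitzFlenner2003, Def. 4.1, Prop. 3.11 and §4 (trace map)] -/
theorem tauC_cyclic (i : K₁ ⟶ K) (p : K ⟶ K₀) (q : ℕ) {d : ℤ}
    (ψ : ShiftedHom (DerivedCategory.Q.obj K₀) (DerivedCategory.Q.obj K₁) d) (m : ℤ) (hm : (0 : ℤ) + ((q : ℤ) + d) = m) :
    tauC X K a b hK q
        ((ShiftedHom.mk₀ (0 : ℤ) rfl (DerivedCategory.Q.map p)).comp
          (ψ.comp (ShiftedHom.mk₀ (0 : ℤ) rfl (DerivedCategory.Q.map i)) (zero_add d)) (add_zero d)) m hm =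
      tauC X K₁ a b hK₁ q
        ((ShiftedHom.mk₀ (0 : ℤ) rfl (DerivedCategory.Q.map (i ≫ p))).comp ψ (add_zero d)) m hm := by
  -- Steps A and B: the middle factor of the left-hand side
  have hB : phiMulAtiyahPowerDeg X K a b hK q
      ((ShiftedHom.mk₀ (0 : ℤ) rfl (DerivedCategory.Q.map p)).comp
        (ψ.comp (ShiftedHom.mk₀ (0 : ℤ) rfl (DerivedCategory.Q.map i)) (zero_add d)) (add_zero d)) =
      (ShiftedHom.mk₀ (0 : ℤ) rfl (DerivedCategory.Q.map ((homFunctor X.left K).map p))).comp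
        ((shiftedHomMap (homFunctor X.left K) (homFunctor_isInvertedBy X K a b hK)
            (ψ.comp (complexAtiyahPowerFrom q K₁) rfl)).comp
          (ShiftedHom.mk₀ (0 : ℤ) rfl (DerivedCategory.Q.map ((homFunctor X.left K).map (twistHodgeComplexMap X q i))))
          (zero_add _)) (add_zero _) := by
    unfold phiMulAtiyahPowerDeg
    rw [extMulAtiyahPowerDeg_gluing, shiftedHomMap_mk₀_comp, shiftedHomMap_comp_mk₀]
  -- the middle factor of the right-hand side
  have hR : phiMulAtiyahPowerDeg X K₁ a b hK₁ q
      ((ShiftedHom.mk₀ (0 : ℤ) rfl (DerivedCategory.Q.map (i ≫ p))).comp ψ (add_zero d)) =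
      (ShiftedHom.mk₀ (0 : ℤ) rfl (DerivedCategory.Q.map ((homFunctor X.left K₁).map (i ≫ p)))).comp
        (shiftedHomMap (homFunctor X.left K₁) (homFunctor_isInvertedBy X K₁ a b hK₁)
            (ψ.comp (complexAtiyahPowerFrom q K₁) rfl)) (add_zero _) := by
    unfold phiMulAtiyahPowerDeg extMulAtiyahPowerDeg
    rw [shiftedHom_mk₀_comp_comp, shiftedHomMap_mk₀_comp]
  -- the tail `Q(𝓗om•(K, i ⊗ 1)) ≫ Q(Tr•^H_K) = Q(𝓗om•(i, K₁ ⊗ Ω^q)) ≫ Q(Tr•^H_{K₁})`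
  have hT : DerivedCategory.Q.map ((homFunctor X.left K).map (twistHodgeComplexMap X q i)) ≫
      DerivedCategory.Q.map (supertraceH X K hK q) =
      DerivedCategory.Q.map ((premapNatTrans X.left i).app (twistHodgeComplex X q K₁)) ≫
        DerivedCategory.Q.map (supertraceH X K₁ hK₁ q) := by
    rw [← Functor.map_comp, ← Functor.map_comp, supertraceH_dinatural X hK₁ hK q i]
  have hL : tauC X K a b hK q
      ((ShiftedHom.mk₀ (0 : ℤ) rfl (DerivedCategory.Q.map p)).comp
        (ψ.comp (ShiftedHom.mk₀ (0 : ℤ) rfl (DerivedCategory.Q.map i)) (zero_add d)) (add_zero d)) m hm =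
      ((ShiftedHom.mk₀ (0 : ℤ) rfl
          (unitQ X K₁ a b ≫ DerivedCategory.Q.map ((homFunctor X.left K₁).map (i ≫ p)))).comp
        (shiftedHomMap (homFunctor X.left K₁) (homFunctor_isInvertedBy X K₁ a b hK₁)
            (ψ.comp (complexAtiyahPowerFrom q K₁) (rfl : (q : ℤ) + d = (q : ℤ) + d))) (add_zero ((q : ℤ) + d))).comp
        (ShiftedHom.mk₀ (0 : ℤ) rfl (DerivedCategory.Q.map (supertraceH X K₁ hK₁ q))) hm := by
    unfold tauC
    rw [hB, ShiftedHom.mk₀_comp_mk₀_assoc, ← shiftedHom_mk₀_comp_comp, shiftedHom_comp_mk₀_comp_mk₀_cast, hT,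
      ← shiftedHom_comp_mk₀_comp_mk₀_cast, shiftedHom_mk₀_comp_comp, shiftedHomMap_premap X i a b hK₁ hK,
      ShiftedHom.mk₀_comp_mk₀_assoc, Category.assoc, unitQ_comp_map_comp_premap X a b i p]
  have hR' : tauC X K₁ a b hK₁ q
      ((ShiftedHom.mk₀ (0 : ℤ) rfl (DerivedCategory.Q.map (i ≫ p))).comp ψ (add_zero d)) m hm =
      ((ShiftedHom.mk₀ (0 : ℤ) rfl
          (unitQ X K₁ a b ≫ DerivedCategory.Q.map ((homFunctor X.left K₁).map (i ≫ p)))).comp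
        (shiftedHomMap (homFunctor X.left K₁) (homFunctor_isInvertedBy X K₁ a b hK₁)
            (ψ.comp (complexAtiyahPowerFrom q K₁) (rfl : (q : ℤ) + d = (q : ℤ) + d))) (add_zero ((q : ℤ) + d))).comp
        (ShiftedHom.mk₀ (0 : ℤ) rfl (DerivedCategory.Q.map (supertraceH X K₁ hK₁ q))) hm := by
    unfold tauC
    rw [hR, ShiftedHom.mk₀_comp_mk₀_assoc]
  exact hL.trans hR'.symm

/-! ## §4 Corollaries: LAW A′ (gluing classes of every degree are invisible) -/

set_option backward.isDefEq.respectTransparency false in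
include hK₁ in
/-- **LAW A′ — `τ` kills GLUING classes in every Ext-degree** (TH2-SIGMA-GLUING-LAWS v1.7 §1): for chain maps `i : K₁• ⟶ K•`, `p : K• ⟶ K₀•`
with `i ≫ p = 0` and any `ψ : Q K₀• ⟶ (Q K₁•)⟦d⟧`, the class `Q p ≫ ψ ≫ Q i⟦d⟧ ∈ Ext^d(K•, K•)` has `τ_q^K = 0` for every `q`.  At `d = 2`
this is `sigmaC_gluing` (via `tauC_two_eq_sigmaC`); at `d = 1` it says that first-order deformations of a glued object which move only the
gluing data (classes factoring `K• → K₀• ⇝ K₁•[1] → K•[1]`) are invisible to every Atiyah–trace map. Proof = `sigmaC_gluing`'s with `2 ↦ d` (the head `unitQ_comp_map_comp_premap_eq_zero` vanishes).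
[cite: BuchweitzFlenner2003, Def. 4.1, Prop. 3.11 and §4 (trace map)] -/
theorem tauC_gluing (i : K₁ ⟶ K) (p : K ⟶ K₀) (hip : i ≫ p = 0) (q : ℕ) {d : ℤ}
    (ψ : ShiftedHom (DerivedCategory.Q.obj K₀) (DerivedCategory.Q.obj K₁) d) (m : ℤ) (hm : (0 : ℤ) + ((q : ℤ) + d) = m) :
    tauC X K a b hK q
        ((ShiftedHom.mk₀ (0 : ℤ) rfl (DerivedCategory.Q.map p)).comp
          (ψ.comp (ShiftedHom.mk₀ (0 : ℤ) rfl (DerivedCategory.Q.map i)) (zero_add d)) (add_zero d)) m hm = 0 := by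
  -- Steps A and B: the middle factor
  have hB : phiMulAtiyahPowerDeg X K a b hK q
      ((ShiftedHom.mk₀ (0 : ℤ) rfl (DerivedCategory.Q.map p)).comp
        (ψ.comp (ShiftedHom.mk₀ (0 : ℤ) rfl (DerivedCategory.Q.map i)) (zero_add d)) (add_zero d)) =
      (ShiftedHom.mk₀ (0 : ℤ) rfl (DerivedCategory.Q.map ((homFunctor X.left K).map p))).comp
        ((shiftedHomMap (homFunctor X.left K) (homFunctor_isInvertedBy X K a b hK)
            (ψ.comp (complexAtiyahPowerFrom q K₁) rfl)).comp
          (ShiftedHom.mk₀ (0 : ℤ) rfl (DerivedCategory.Q.map ((homFunctor X.left K).map (twistHodgeComplexMap X q i))))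
          (zero_add _)) (add_zero _) := by
    unfold phiMulAtiyahPowerDeg
    rw [extMulAtiyahPowerDeg_gluing, shiftedHomMap_mk₀_comp, shiftedHomMap_comp_mk₀]
  -- the tail `Q(𝓗om•(K, i ⊗ 1)) ≫ Q(Tr•^H_K) = Q(𝓗om•(i, K₁ ⊗ Ω^q)) ≫ Q(Tr•^H_{K₁})`
  have hT : DerivedCategory.Q.map ((homFunctor X.left K).map (twistHodgeComplexMap X q i)) ≫
      DerivedCategory.Q.map (supertraceH X K hK q) =
      DerivedCategory.Q.map ((premapNatTrans X.left i).app (twistHodgeComplex X q K₁)) ≫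
        DerivedCategory.Q.map (supertraceH X K₁ hK₁ q) := by
    rw [← Functor.map_comp, ← Functor.map_comp, supertraceH_dinatural X hK₁ hK q i]
  unfold tauC
  rw [hB, ShiftedHom.mk₀_comp_mk₀_assoc, ← shiftedHom_mk₀_comp_comp, shiftedHom_comp_mk₀_comp_mk₀_cast, hT,
    ← shiftedHom_comp_mk₀_comp_mk₀_cast, shiftedHom_mk₀_comp_comp, shiftedHomMap_premap X i a b hK₁ hK,
    ShiftedHom.mk₀_comp_mk₀_assoc, Category.assoc, unitQ_comp_map_comp_premap_eq_zero X a b i p hip, ShiftedHom.mk₀_zero,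
    ShiftedHom.zero_comp, ShiftedHom.zero_comp]

/-- **Extension classes of a short complex are `τ`-invisible in every degree**: for a short complex `T = (K₁• →f K• →g K₀•)` of cochain
complexes (`f ≫ g = 0`) and any `ψ : Q K₀• ⟶ (Q K₁•)⟦d⟧`, `τ_q^K(Q g ≫ ψ ≫ Q f⟦d⟧) = 0` (`tauC_gluing` at `(i, p) := (T.f, T.g)`).
[cite: BuchweitzFlenner2003, Def. 4.1, Prop. 3.11 and §4 (trace map)] -/
theorem tauC_shortComplex_ext_eq_zero (T : ShortComplex (CochainComplex X.left.Modules ℤ))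
    [T.X₁.IsStrictlyGE a] [T.X₁.IsStrictlyLE b] [T.X₂.IsStrictlyGE a] [T.X₂.IsStrictlyLE b]
    (hT₁ : ∀ n, IsFiniteLocallyFree (T.X₁.X n)) (hT₂ : ∀ n, IsFiniteLocallyFree (T.X₂.X n)) (q : ℕ) {d : ℤ}
    (ψ : ShiftedHom (DerivedCategory.Q.obj T.X₃) (DerivedCategory.Q.obj T.X₁) d) (m : ℤ) (hm : (0 : ℤ) + ((q : ℤ) + d) = m) :
    tauC X T.X₂ a b hT₂ q
        ((ShiftedHom.mk₀ (0 : ℤ) rfl (DerivedCategory.Q.map T.g)).comp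
          (ψ.comp (ShiftedHom.mk₀ (0 : ℤ) rfl (DerivedCategory.Q.map T.f)) (zero_add d)) (add_zero d)) m hm = 0 :=
  tauC_gluing X a b hT₁ hT₂ T.f T.g T.zero q ψ m hm

end Cyclic

/-! ## §5 Staircases: LAW A′ iterated along a filtration (TH2-SIGMA-GLUING-LAWS v1.8 §1, «the multi-step staircase
follows by iterating along the filtration»)

For a THREE-step filtration `K₂• ⊂ K₁• ⊂ K•` (chain maps `j : K₂• ⟶ K₁•`, `i : K₁• ⟶ K•`; quotients `p : K• ⟶ K₀•`
playing `K•/K₂•` and `r : K₁• ⟶ L•` playing `K₁•/K₂•`, with `j ≫ r = 0` and the square `i ≫ p = r ≫ ī` for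
`ī : L• ⟶ K₀•`), a class of `F¹Ext^d(K•, K•)` — chain level: `f(K) ⊂ K₁`, `f(K₁) ⊂ K₂`, `f(K₂) = 0` — has the
derived shape `Q p ≫ g ≫ Q i⟦d⟧` with `g : Q K₀• ⟶ (Q K₁•)⟦d⟧` whose restriction to `Q L•` factors through
`Q K₂•`: `Q ī ≫ g = g′ ≫ Q j⟦d⟧`.  Such classes are `τ`-invisible in every degree: rotate by `tauC_cyclic`
to `τ^{K₁}(Q(i ≫ p) ≫ g) = τ^{K₁}(Q r ≫ (Q ī ≫ g)) = τ^{K₁}(Q r ≫ g′ ≫ Q j⟦d⟧)`, which `tauC_gluing` kills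
(`j ≫ r = 0`).  Longer staircases iterate `tauC_eq_zero_of_rotate` the same way (one factorisation hypothesis
per step).  Theorems only; no definition, no fact. -/

section Staircase

universe w₁ u₁

variable {S : Type u₁} [CommRing S] (X : Over (Spec (CommRingCat.of S))) [HasDerivedCategory.{w₁} X.left.Modules]
  {K₂ K₁ K K₀ L : CochainComplex X.left.Modules ℤ} (a b : ℤ)
  [K₂.IsStrictlyGE a] [K₂.IsStrictlyLE b] [K₁.IsStrictlyGE a] [K₁.IsStrictlyLE b] [K.IsStrictlyGE a] [K.IsStrictlyLE b]
  (hK₂ : ∀ n, IsFiniteLocallyFree (K₂.X n)) (hK₁ : ∀ n, IsFiniteLocallyFree (K₁.X n))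
  (hK : ∀ n, IsFiniteLocallyFree (K.X n))

set_option backward.isDefEq.respectTransparency false in
/-- **Rotate-to-zero** (the induction step along a filtration): for chain maps `i : K₁• ⟶ K•`, `p : K• ⟶ K₀•` (no relation
assumed) and `ψ : Q K₀• ⟶ (Q K₁•)⟦d⟧`, if the ROTATED class `Q(i ≫ p) ≫ ψ ∈ Ext^d(K₁•, K₁•)` is `τ_q`-invisible on the
sub-object `K₁•`, then `Q p ≫ ψ ≫ Q i⟦d⟧ ∈ Ext^d(K•, K•)` is `τ_q`-invisible on `K•` (immediate from `tauC_cyclic`).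
[cite: BuchweitzFlenner2003, Def. 4.1, Prop. 3.11 and §4 (trace map)] -/
theorem tauC_eq_zero_of_rotate (i : K₁ ⟶ K) (p : K ⟶ K₀) (q : ℕ) {d : ℤ}
    (ψ : ShiftedHom (DerivedCategory.Q.obj K₀) (DerivedCategory.Q.obj K₁) d) (m : ℤ) (hm : (0 : ℤ) + ((q : ℤ) + d) = m)
    (h : tauC X K₁ a b hK₁ q
        ((ShiftedHom.mk₀ (0 : ℤ) rfl (DerivedCategory.Q.map (i ≫ p))).comp ψ (add_zero d)) m hm = 0) :
    tauC X K a b hK q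
        ((ShiftedHom.mk₀ (0 : ℤ) rfl (DerivedCategory.Q.map p)).comp
          (ψ.comp (ShiftedHom.mk₀ (0 : ℤ) rfl (DerivedCategory.Q.map i)) (zero_add d)) (add_zero d)) m hm = 0 := by
  rw [tauC_cyclic X a b hK₁ hK i p q ψ m hm]
  exact h

set_option backward.isDefEq.respectTransparency false in
include hK₂ hK₁ in
/-- **LAW A′ for a THREE-STEP staircase.**  Chain maps `j : K₂• ⟶ K₁•`, `i : K₁• ⟶ K•`, `p : K• ⟶ K₀•`, `r : K₁• ⟶ L•`,
`ī : L• ⟶ K₀•` with `j ≫ r = 0` and `i ≫ p = r ≫ ī` (in the application: `K₀• = K•/K₂•`, `L• = K₁•/K₂•`, `ī` the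
inclusion); a class `g : Q K₀• ⟶ (Q K₁•)⟦d⟧` whose restriction along `Q ī` factors through `Q K₂•`,
`Q ī ≫ g = g′ ≫ Q j⟦d⟧` — i.e. `Q p ≫ g ≫ Q i⟦d⟧` is a class of `F¹Ext^d` for the three-step filtration.  Then
`τ_q^K(Q p ≫ g ≫ Q i⟦d⟧) = 0` for every `q`: rotate (`tauC_eq_zero_of_rotate`), rewrite `Q(i ≫ p) = Q r ≫ Q ī`,
reassociate, substitute the factorisation, and apply `tauC_gluing` to `(j, r)`.  `K₂•`, `K₁•`, `K•` bounded in
`[a, b]` with finite locally free terms. [cite: BuchweitzFlenner2003, Def. 4.1, Prop. 3.11 and §4 (trace map)] -/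
theorem tauC_gluing₃ (j : K₂ ⟶ K₁) (i : K₁ ⟶ K) (p : K ⟶ K₀) (r : K₁ ⟶ L) (ī : L ⟶ K₀)
    (hjr : j ≫ r = 0) (hsq : i ≫ p = r ≫ ī) (q : ℕ) {d : ℤ}
    (g : ShiftedHom (DerivedCategory.Q.obj K₀) (DerivedCategory.Q.obj K₁) d)
    (g' : ShiftedHom (DerivedCategory.Q.obj L) (DerivedCategory.Q.obj K₂) d)
    (hfac : (ShiftedHom.mk₀ (0 : ℤ) rfl (DerivedCategory.Q.map ī)).comp g (add_zero d) =
      g'.comp (ShiftedHom.mk₀ (0 : ℤ) rfl (DerivedCategory.Q.map j)) (zero_add d))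
    (m : ℤ) (hm : (0 : ℤ) + ((q : ℤ) + d) = m) :
    tauC X K a b hK q
        ((ShiftedHom.mk₀ (0 : ℤ) rfl (DerivedCategory.Q.map p)).comp
          (g.comp (ShiftedHom.mk₀ (0 : ℤ) rfl (DerivedCategory.Q.map i)) (zero_add d)) (add_zero d)) m hm = 0 := by
  refine tauC_eq_zero_of_rotate X a b hK₁ hK i p q g m hm ?_
  have e : ShiftedHom.mk₀ (0 : ℤ) rfl (DerivedCategory.Q.map (i ≫ p)) =
      (ShiftedHom.mk₀ (0 : ℤ) rfl (DerivedCategory.Q.map r)).comp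
        (ShiftedHom.mk₀ (0 : ℤ) rfl (DerivedCategory.Q.map ī)) (add_zero 0) := by
    rw [hsq, Functor.map_comp, ShiftedHom.mk₀_comp_mk₀]
  rw [e, shiftedHom_mk₀_comp_comp (DerivedCategory.Q.map r) (ShiftedHom.mk₀ (0 : ℤ) rfl (DerivedCategory.Q.map ī)) g
    (add_zero d), hfac]
  exact tauC_gluing X a b hK₂ hK₁ j r hjr q g' m hm

end Staircase

end HomComplex

end Summit.Ventures.HSemireg

end
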